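import Summits.QuantumFields.BalabanUV.Beta.FP.LegPairingTable
import Literature.MathematicalPhysics.QuantumFieldTheory.Balaban1983to89.Beta.GradedBubbles

/-!
# `BalabanUV.Beta.FP.LegPairingBounds` — THE REMAINDER OF THE TAYLOR PAIRING IS `O(‖p−q‖∞⁻⁷)`: pointwise bounds of the remainder integrand from GRADED decay of
# the leg (`|Δ^α A(x,y)| ≤ C/(‖x−y‖∞+1)^{2+|α|}`, `|α| ≤ 3`) WITHOUT any near ∕ far region split (road «FP», LEGS generic track, module (R) part 1; [folklore], `ℤ⁴`)

HONEST DEPENDENCY (page 1, mandatory): continuum YM on T⁴ ⇐ BetaPertH ∧ nine spine estimates (0/9 proved); BetaPertH ⇐ (D1) ∧ (D4) ∧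
CAP+tail; G-an2-4 gates asym, D1 and NE2/3/4.  HONEST FRAMING (cell contract, verbatim): «discharging `BetaPertH` makes Bałaban's UV
stability UNCONDITIONAL — a real constructive-QFT result; it is NOT the continuum limit and NOT the Clay problem.»  THIS MODULE is elementary
[folklore] analysis on `ℤ⁴` over `FP/LegPairingTable`, `FP/LatticeTaylorIndex`, `FP/StencilMoments`, the tree's `DyadicShell`/`BlockLegs` sup-norm lemmas; it asserts
nothing about Bałaban's objects, cites nothing, mints no `Prop` fact, 0 `def`, 0 sorry.  The GRADED leg bounds are HYPOTHESES (for road FP's perfect propagator they are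
the N7 window ∕ tail rows MS-3+4 of the owner's N7 PLAN v1, not proved here).  NOT `hlegs`, NOT D1, NOT BetaPertH, NOT continuum, NOT Clay.

THE ONE TRICK (§1, `inv_pow_le_of_box`).  For the base points `p, q` at sup-distance `L`, a point `ξ` in the box of radius `‖x−p‖∞` about `p` and any `y`:
`L + 2 ≤ 2·(‖x−p‖∞ + ‖y−q‖∞ + 1)·(‖ξ−y‖∞ + 1)` (triangle inequality and `a + b ≤ 2ab` for `a, b ≥ 1`), hence
`1/(‖ξ−y‖∞+1)^k ≤ (2(‖x−p‖∞+‖y−q‖∞+1))^k/(L+2)^k` GLOBALLY — the loss is a polynomial weight in the distances to the localisation centres, which the stencils'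
exponential localisation absorbs (`StencilMoments`).  So the Taylor remainder of `A(·, y)` about `p` (third differences, `LatticeTaylorIndex.abs_sub_sum_mono_le`) is
`≤ K·(‖x−p‖∞+1)^8·(‖y−q‖∞+1)^5/(L+2)^5` for ALL `x, y` (§2), the composed rows obey `|(dKer ι A ∘ V)(p,z)| ≲ e^{−δ|z−q|₁}/(L+2)²`,
`|(remKer p A ∘ V)(x,z)| ≲ (‖x−p‖+1)^8 e^{−δ|z−q|₁}/(L+2)^5`, `|(A ∘ W)(z,x)| ≲ (‖z−q‖+1)² e^{−δ|x−p|₁}/(L+2)²` (§3 the transfer through `comp`,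
§4 the difference legs at the row `p`, §5 the four composed rows).  Part 2 (`FP/LegPairingRemainder`) assembles from §5 the bi-localisation of the remainder
integrand `remTerm` of `LegPairingTable` at `(p, q)` (rate `δ/2`, constant `K_rem/(L+2)^7`) and sums it.
Unit `b2b-balaban-beta-d1-formalise-leaf-02` (gen 5).
-/

noncomputable section

namespace Summit.QuantumFields.BalabanUV.Beta.FP.LegPairingBounds

open Finset fwdDiff
open scoped BigOperators
open Literature.MathematicalPhysics.QuantumFieldTheory.Balaban1983to89
open Literature.MathematicalPhysics.QuantumFieldTheory.Balaban1983to89.Beta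
open B12Sec2to5 (l1 l1_nonneg)
open ExpKernelCalculus (Site MKer BiLoc comp tr bubble Zl Zl_pos summable_exp_shift' tsum_exp_shift')
open KernelWard (Bdd)
open DyadicShell (Pt supNorm natAbs_le_supNorm supNorm_le_iff exists_eq_supNorm)
open BlockLegs (supNorm_add_le_real supNorm_sub_le_real)
open GradedBubbles (supNorm_neg)
open Summit.QuantumFields.BalabanUV.Beta.FP.LatticeTaylorIndex (Idx mono dOp abs_mono_le abs_sub_sum_mono_le)
open Summit.QuantumFields.BalabanUV.Beta.FP.StencilMoments (summable_of_weight_exp pow_succ_mul_exp_le')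
open Summit.QuantumFields.BalabanUV.Beta.FP.LegPairing (dKer remKer sLeg)
open Summit.QuantumFields.BalabanUV.Beta.FP.LegPairingTable (tableTerm remTerm)

variable {F : Type*} [Fintype F]

/-! ## §1 Sup-norm geometry on `ℤ⁴`: the global comparison -/

/-- [folklore] Triangle inequality in the difference form `‖a − c‖∞ ≤ ‖a − b‖∞ + ‖b − c‖∞` (reals). -/
theorem supNorm_sub_triangle (a b c : Pt) : (supNorm (a - c) : ℝ) ≤ supNorm (a - b) + supNorm (b - c) := by
  have := supNorm_add_le_real (a - b) (b - c)
  rwa [show a - b + (b - c) = a - c by abel] at this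

/-- [folklore] `‖a − b‖∞ = ‖b − a‖∞`. -/
theorem supNorm_sub_comm (a b : Pt) : supNorm (a - b) = supNorm (b - a) := by
  rw [← supNorm_neg, neg_sub]

/-- [folklore] The sup norm is at most the ℓ¹ size: `‖w‖∞ ≤ |w|₁`. -/
theorem supNorm_le_l1 (w : Pt) : (supNorm w : ℝ) ≤ l1 w := by
  obtain ⟨i, hi⟩ := exists_eq_supNorm w
  rw [← hi, Nat.cast_natAbs, Int.cast_abs]
  exact Finset.single_le_sum (f := fun μ => |(w μ : ℝ)|) (fun _ _ => abs_nonneg _) (Finset.mem_univ i)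

/-- [folklore] A box point is coordinatewise close: `(∀ i, |ξ i − p i| ≤ R) → ‖ξ − p‖∞ ≤ R`. -/
theorem supNorm_le_of_coord {ξ p : Pt} {R : ℕ} (h : ∀ i, |ξ i - p i| ≤ (R : ℤ)) : supNorm (ξ - p) ≤ R := by
  rw [supNorm_le_iff]
  intro i
  have := h i
  rw [← Int.ofNat_le, Int.natCast_natAbs]
  simpa using this

/-- **THE GLOBAL COMPARISON**: for `ξ` in the box of radius `‖x − p‖∞` about `p`,
`‖p − q‖∞ + 2 ≤ 2·(‖x−p‖∞ + ‖y−q‖∞ + 1)·(‖ξ−y‖∞ + 1)`. [folklore] -/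
theorem dist_add_two_le (p q x y ξ : Pt) (hξ : supNorm (ξ - p) ≤ supNorm (x - p)) :
    (supNorm (p - q) : ℝ) + 2 ≤ 2 * ((supNorm (x - p) : ℝ) + supNorm (y - q) + 1) * ((supNorm (ξ - y) : ℝ) + 1) := by
  have h1 : (supNorm (p - q) : ℝ) ≤ supNorm (p - ξ) + supNorm (ξ - y) + supNorm (y - q) := by
    linarith [supNorm_sub_triangle p ξ q, supNorm_sub_triangle ξ y q]
  have h2 : (supNorm (p - ξ) : ℝ) ≤ supNorm (x - p) := by rw [supNorm_sub_comm]; exact_mod_cast hξ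
  have ha : (1 : ℝ) ≤ (supNorm (x - p) : ℝ) + supNorm (y - q) + 1 := by
    have : (0 : ℝ) ≤ supNorm (x - p) := Nat.cast_nonneg _
    have : (0 : ℝ) ≤ supNorm (y - q) := Nat.cast_nonneg _
    linarith
  have hb : (1 : ℝ) ≤ (supNorm (ξ - y) : ℝ) + 1 := by
    have : (0 : ℝ) ≤ supNorm (ξ - y) := Nat.cast_nonneg _
    linarith
  -- `L + 2 ≤ a + b ≤ 2ab`
  nlinarith [mul_nonneg (sub_nonneg.mpr ha) (sub_nonneg.mpr hb)]

/-- **THE GLOBAL COMPARISON, POWER FORM**: `1/(‖ξ−y‖∞+1)^k ≤ (2(‖x−p‖∞+‖y−q‖∞+1))^k/(‖p−q‖∞+2)^k` for `ξ` in the box of radius `‖x−p‖∞` about `p`. [folklore] -/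
theorem inv_pow_le_of_box (p q x y ξ : Pt) (hξ : supNorm (ξ - p) ≤ supNorm (x - p)) (k : ℕ) :
    1 / ((supNorm (ξ - y) : ℝ) + 1) ^ k
      ≤ (2 * ((supNorm (x - p) : ℝ) + supNorm (y - q) + 1)) ^ k / ((supNorm (p - q) : ℝ) + 2) ^ k := by
  have h := dist_add_two_le p q x y ξ hξ
  have hL : (0 : ℝ) < (supNorm (p - q) : ℝ) + 2 := by positivity
  have hb : (0 : ℝ) < (supNorm (ξ - y) : ℝ) + 1 := by positivity
  rw [div_le_div_iff₀ (pow_pos hb k) (pow_pos hL k), one_mul, ← mul_pow]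
  exact pow_le_pow_left₀ hL.le (by linarith) k

/-! ## §2 The Taylor remainder of the leg is globally `O((L+2)⁻⁵)` with polynomial weights -/

section Leg

variable {A : MKer 4 F} {C : ℝ}

omit [Fintype F] in
/-- [folklore] THE GRADED HYPOTHESIS, ORDER THREE, read on the box: every third difference of `x′ ↦ A x′ y a b` at every `ξ` with `‖ξ−p‖∞ ≤ ‖x−p‖∞` is
`≤ C·(2(‖x−p‖∞+‖y−q‖∞+1))^5/(‖p−q‖∞+2)^5`. -/
theorem third_diff_le_on_box (hC : 0 ≤ C)
    (h3 : ∀ (i j k : Fin 4) (x y : Pt) (a b : F),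
      |Δ_[(Pi.single i 1 : Pt)] (Δ_[(Pi.single j 1 : Pt)] (Δ_[(Pi.single k 1 : Pt)] fun x' => A x' y a b)) x| ≤ C / ((supNorm (x - y) : ℝ) + 1) ^ 5)
    (p q x y : Pt) (a b : F) (ξ : Pt) (hξ : ∀ i, |ξ i - p i| ≤ ((supNorm (x - p) : ℕ) : ℤ)) (i j k : Fin 4) :
    |Δ_[(Pi.single i 1 : Pt)] (Δ_[(Pi.single j 1 : Pt)] (Δ_[(Pi.single k 1 : Pt)] fun x' => A x' y a b)) ξ|
      ≤ C * (2 * ((supNorm (x - p) : ℝ) + supNorm (y - q) + 1)) ^ 5 / ((supNorm (p - q) : ℝ) + 2) ^ 5 := by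
  refine (h3 i j k ξ y a b).trans ?_
  rw [div_eq_mul_one_div, mul_div_assoc]
  exact mul_le_mul_of_nonneg_left (inv_pow_le_of_box p q x y ξ (supNorm_le_of_coord hξ) 5) hC

omit [Fintype F] in
/-- **THE TAYLOR REMAINDER OF THE LEG IS GLOBALLY `O((‖p−q‖∞+2)⁻⁵)`** with polynomial weights in the distances to the centres:
`|remKer p A x y a b| ≤ 3200·C·(‖x−p‖∞+1)^8·(‖y−q‖∞+1)^5 / (‖p−q‖∞+2)^5` for ALL `x, y` (order-two Taylor along the coordinate path, `D = 4`:
`4·5² = 100` × the cube of the radius × `2⁵ = 32` × the comparison weight). [folklore] -/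
theorem abs_remKer_le (hC : 0 ≤ C)
    (h3 : ∀ (i j k : Fin 4) (x y : Pt) (a b : F),
      |Δ_[(Pi.single i 1 : Pt)] (Δ_[(Pi.single j 1 : Pt)] (Δ_[(Pi.single k 1 : Pt)] fun x' => A x' y a b)) x| ≤ C / ((supNorm (x - y) : ℝ) + 1) ^ 5)
    (p q x y : Pt) (a b : F) :
    |remKer p A x y a b|
      ≤ 3200 * C * ((supNorm (x - p) : ℝ) + 1) ^ 8 * ((supNorm (y - q) : ℝ) + 1) ^ 5 / ((supNorm (p - q) : ℝ) + 2) ^ 5 := by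
  set r : ℝ := (supNorm (x - p) : ℝ) with hr
  set u : ℝ := (supNorm (y - q) : ℝ) with hu
  set L : ℝ := (supNorm (p - q) : ℝ) with hL
  have hr0 : 0 ≤ r := Nat.cast_nonneg _
  have hu0 : 0 ≤ u := Nat.cast_nonneg _
  have hL2 : 0 < L + 2 := by have : (0 : ℝ) ≤ L := Nat.cast_nonneg _; linarith
  -- the order-two Taylor bound with `R := ‖x−p‖∞`, `B := C (2(r+u+1))^5/(L+2)^5`
  have hB : 0 ≤ C * (2 * (r + u + 1)) ^ 5 / (L + 2) ^ 5 := by positivity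
  have hs : ∀ i, |(x - p) i| ≤ ((supNorm (x - p) : ℕ) : ℤ) := fun i => by
    rw [← Int.natCast_natAbs]; exact_mod_cast natAbs_le_supNorm (x - p) i
  have key := abs_sub_sum_mono_le (D := 4) (fun x' => A x' y a b) p (x - p) hs hB (fun ξ hξ i j k => by
    have hξ' : ∀ i, |ξ i - p i| ≤ ((supNorm (x - p) : ℕ) : ℤ) := fun i => by simpa using hξ i
    exact third_diff_le_on_box hC h3 p q x y a b ξ hξ' i j k)
  have e : (fun x' => A x' y a b) (p + (x - p)) - ∑ ι : Idx 4, mono ι (x - p) * dOp ι (fun x' => A x' y a b) p = remKer p A x y a b := by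
    simp only [remKer, dKer, add_sub_cancel]
  rw [e] at key
  refine key.trans ?_
  -- `4·(4+1)²·r³·C·32(r+u+1)^5/(L+2)^5 ≤ 3200 C (r+1)^8 (u+1)^5/(L+2)^5`
  have h1 : ((supNorm (x - p) : ℕ) : ℝ) ^ 3 ≤ (r + 1) ^ 3 := by
    rw [← hr]; exact pow_le_pow_left₀ hr0 (by linarith) 3
  have h2 : (2 * (r + u + 1)) ^ 5 ≤ 32 * ((r + 1) ^ 5 * (u + 1) ^ 5) := by
    have hab : r + u + 1 ≤ (r + 1) * (u + 1) := by nlinarith [mul_nonneg hr0 hu0]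
    have h0 : 0 ≤ r + u + 1 := by positivity
    calc (2 * (r + u + 1)) ^ 5 = 32 * (r + u + 1) ^ 5 := by ring
      _ ≤ 32 * ((r + 1) * (u + 1)) ^ 5 := by gcongr
      _ = 32 * ((r + 1) ^ 5 * (u + 1) ^ 5) := by ring
  have h3' : (r + 1) ^ 3 * ((r + 1) ^ 5 * (u + 1) ^ 5) = (r + 1) ^ 8 * (u + 1) ^ 5 := by ring
  calc (4 : ℝ) * ((4 : ℝ) + 1) ^ 2 * ((supNorm (x - p) : ℕ) : ℝ) ^ 3 * (C * (2 * (r + u + 1)) ^ 5 / (L + 2) ^ 5)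
      = 100 * (((supNorm (x - p) : ℕ) : ℝ) ^ 3 * (2 * (r + u + 1)) ^ 5) * C / (L + 2) ^ 5 := by ring
    _ ≤ 100 * ((r + 1) ^ 3 * (32 * ((r + 1) ^ 5 * (u + 1) ^ 5))) * C / (L + 2) ^ 5 := by
        gcongr
    _ = 3200 * C * (r + 1) ^ 8 * (u + 1) ^ 5 / (L + 2) ^ 5 := by ring

end Leg


/-! ## §3 Composed rows against bi-localised stencils: polynomially weighted row bounds pass through `comp` -/

section Comp

variable {K V : MKer 4 F} {q q' x : Pt} {M Cv δ : ℝ} {k : ℕ}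

/-- **A POLYNOMIALLY WEIGHTED ROW BOUND PASSES THROUGH THE COMPOSITION WITH A BI-LOCALISED KERNEL**: if the row `x` of `K` obeys
`|K x y a f| ≤ M·(‖y−q‖∞+1)^k` and `V` is bi-localised at `(q, q′)` (rate `δ > 0`), then
`|comp K V x z a c| ≤ |F|·M·C_V·(k!·e^{δ/2}·(2/δ)^k·Zl(δ/2))·e^{−δ|z−q′|₁}`. [folklore] -/
theorem abs_comp_weight_biLoc_le (hM : 0 ≤ M) (hδ : 0 < δ) (hK : ∀ (y : Pt) (a f : F), |K x y a f| ≤ M * ((supNorm (y - q) : ℝ) + 1) ^ k)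
    (hV : BiLoc V q q' Cv δ) (z : Pt) (a c : F) :
    |comp K V x z a c| ≤ (Fintype.card F : ℝ) * M * Cv * (((k.factorial : ℝ) * Real.exp (δ / 2) * (2 / δ) ^ k) * Zl 4 (δ / 2))
      * Real.exp (-δ * l1 (z - q')) := by
  classical
  have hCv : 0 ≤ Cv := hV.nonneg a
  -- termwise bound in the weight-exp class (variable `y`, centre `q`)
  have hterm : ∀ y, |∑ f, K x y a f * V y z f c|
      ≤ ((Fintype.card F : ℝ) * M * Cv * Real.exp (-δ * l1 (z - q'))) * (l1 (y - q) + 1) ^ k * Real.exp (-δ * l1 (y - q)) := by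
    intro y
    have hw : ((supNorm (y - q) : ℝ) + 1) ^ k ≤ (l1 (y - q) + 1) ^ k :=
      pow_le_pow_left₀ (by positivity) (by linarith [supNorm_le_l1 (y - q)]) k
    calc |∑ f, K x y a f * V y z f c| ≤ ∑ f, |K x y a f * V y z f c| := abs_sum_le_sum_abs _ _
      _ ≤ ∑ _f : F, (M * (l1 (y - q) + 1) ^ k) * (Cv * Real.exp (-δ * (l1 (y - q) + l1 (z - q')))) :=
          Finset.sum_le_sum fun f _ => by
            rw [abs_mul]
            exact mul_le_mul ((hK y a f).trans (mul_le_mul_of_nonneg_left hw hM)) (hV y z f c) (abs_nonneg _)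
              (mul_nonneg hM (pow_nonneg (by linarith [l1_nonneg (y - q)]) k))
      _ = ((Fintype.card F : ℝ) * M * Cv * Real.exp (-δ * l1 (z - q'))) * (l1 (y - q) + 1) ^ k * Real.exp (-δ * l1 (y - q)) := by
          rw [Finset.sum_const, Finset.card_univ, nsmul_eq_mul,
            show -δ * (l1 (y - q) + l1 (z - q')) = -δ * l1 (z - q') + -δ * l1 (y - q) by ring, Real.exp_add]
          ring
  have hC0 : 0 ≤ (Fintype.card F : ℝ) * M * Cv * Real.exp (-δ * l1 (z - q')) := by positivity
  obtain ⟨hs, hb⟩ := summable_of_weight_exp (q := q) (k := k) hδ hC0 hterm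
  unfold comp
  have h1 : |∑' y, ∑ f, K x y a f * V y z f c| ≤ ∑' y, |∑ f, K x y a f * V y z f c| := by
    have := norm_tsum_le_tsum_norm hs.norm
    simpa only [Real.norm_eq_abs] using this
  refine h1.trans (hb.trans (le_of_eq ?_))
  ring

end Comp

/-! ## §4 The difference legs at the row `p` -/

section Rows

variable {A V W : MKer 4 F} {C Cv Cw δ : ℝ} {p q : Pt}

omit [Fintype F] in
/-- [folklore] The four kinds of points of a difference word at `p` lie within sup-distance `2` of `p`. -/
theorem supNorm_word_le (p : Pt) (i k : Fin 4) :
    supNorm (p + (Pi.single k 1 : Pt) - p) ≤ 2 ∧ supNorm (p + (Pi.single k 1 : Pt) + (Pi.single k 1 : Pt) - p) ≤ 2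
      ∧ supNorm (p + (Pi.single i 1 : Pt) + (Pi.single k 1 : Pt) - p) ≤ 2 ∧ supNorm (p - p) ≤ 2 := by
  refine ⟨?_, ?_, ?_, ?_⟩ <;> rw [supNorm_le_iff] <;> intro j
  · rw [show p + (Pi.single k 1 : Pt) - p = Pi.single k 1 by abel]
    rw [Pi.single_apply]; split_ifs <;> decide
  · rw [show p + (Pi.single k 1 : Pt) + (Pi.single k 1 : Pt) - p = Pi.single k 1 + Pi.single k 1 by abel]
    rw [Pi.add_apply, Pi.single_apply]; split_ifs <;> decide
  · rw [show p + (Pi.single i 1 : Pt) + (Pi.single k 1 : Pt) - p = Pi.single i 1 + Pi.single k 1 by abel]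
    rw [Pi.add_apply, Pi.single_apply, Pi.single_apply]; split_ifs <;> decide
  · simp

omit [Fintype F] in
/-- **THE DIFFERENCE LEGS AT THE ROW `p` DECAY LIKE `(‖p−q‖∞+2)⁻²`** (weight `(‖y−q‖∞+1)²`): from the order-zero graded bound
`|A(ξ,y)| ≤ C/(‖ξ−y‖∞+1)²` at the ≤ 4 points `ξ` of the difference word (all within sup-distance 2 of `p`) and the global comparison. [folklore] -/
theorem abs_dKer_row_le (hC : 0 ≤ C) (h0 : ∀ (x y : Pt) (a b : F), |A x y a b| ≤ C / ((supNorm (x - y) : ℝ) + 1) ^ 2)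
    (ι : Idx 4) (y : Pt) (a b : F) :
    |dKer ι A p y a b| ≤ 144 * C / ((supNorm (p - q) : ℝ) + 2) ^ 2 * ((supNorm (y - q) : ℝ) + 1) ^ 2 := by
  set u : ℝ := (supNorm (y - q) : ℝ) with hu
  set L : ℝ := (supNorm (p - q) : ℝ) with hL
  have hu0 : 0 ≤ u := Nat.cast_nonneg _
  have hL2 : 0 < L + 2 := by have : (0 : ℝ) ≤ L := Nat.cast_nonneg _; linarith
  -- every point `ξ` with `‖ξ − p‖∞ ≤ 2` has `|A ξ y| ≤ 36·K`, `K := C/(L+2)²·(u+1)²`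
  set K : ℝ := C / (L + 2) ^ 2 * (u + 1) ^ 2 with hK
  have hpt : ∀ ξ : Pt, supNorm (ξ - p) ≤ 2 → |A ξ y a b| ≤ 36 * K := by
    intro ξ hξ
    refine (h0 ξ y a b).trans ?_
    have hcmp := inv_pow_le_of_box p q ξ y ξ le_rfl 2
    have hξ2 : (supNorm (ξ - p) : ℝ) ≤ 2 := by exact_mod_cast hξ
    have hξ0 : (0 : ℝ) ≤ (supNorm (ξ - p) : ℝ) := Nat.cast_nonneg _
    rw [div_eq_mul_one_div]
    refine (mul_le_mul_of_nonneg_left hcmp hC).trans ?_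
    have h36 : (2 * ((supNorm (ξ - p) : ℝ) + u + 1)) ^ 2 ≤ 36 * (u + 1) ^ 2 := by nlinarith
    calc C * ((2 * ((supNorm (ξ - p) : ℝ) + (supNorm (y - q) : ℝ) + 1)) ^ 2 / ((supNorm (p - q) : ℝ) + 2) ^ 2)
        = C * (2 * ((supNorm (ξ - p) : ℝ) + u + 1)) ^ 2 / (L + 2) ^ 2 := by rw [hu, hL]; ring
      _ ≤ C * (36 * (u + 1) ^ 2) / (L + 2) ^ 2 := by gcongr
      _ = 36 * K := by rw [hK]; ring
  have hp0 : supNorm (p - p) ≤ 2 := by rw [supNorm_le_iff]; intro j; simp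
  have e144 : 144 * C / ((supNorm (p - q) : ℝ) + 2) ^ 2 * ((supNorm (y - q) : ℝ) + 1) ^ 2 = 144 * K := by rw [hK, hu, hL]; ring
  rw [e144]
  rcases ι with w | k | k | ⟨i, k⟩
  · simp only [dKer, LatticeTaylorIndex.dOp_inl]
    have a0 := hpt p hp0
    have hK0 : 0 ≤ K := by rw [hK]; positivity
    linarith
  · simp only [dKer, LatticeTaylorIndex.dOp_inr_inl, fwdDiff]
    have a1 := hpt _ (supNorm_word_le p k k).1
    have a0 := hpt p hp0
    have hK0 : 0 ≤ K := by rw [hK]; positivity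
    refine (abs_sub _ _).trans ?_
    linarith
  · simp only [dKer, LatticeTaylorIndex.dOp_inr_inr_inl, fwdDiff]
    have a2 := hpt _ (supNorm_word_le p k k).2.1
    have a1 := hpt _ (supNorm_word_le p k k).1
    have a0 := hpt p hp0
    calc |A (p + Pi.single k 1 + Pi.single k 1) y a b - A (p + Pi.single k 1) y a b - (A (p + Pi.single k 1) y a b - A p y a b)|
        ≤ |A (p + Pi.single k 1 + Pi.single k 1) y a b - A (p + Pi.single k 1) y a b| + |A (p + Pi.single k 1) y a b - A p y a b| := abs_sub _ _
      _ ≤ (|A (p + Pi.single k 1 + Pi.single k 1) y a b| + |A (p + Pi.single k 1) y a b|) + (|A (p + Pi.single k 1) y a b| + |A p y a b|) :=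
          add_le_add (abs_sub _ _) (abs_sub _ _)
      _ ≤ 144 * K := by linarith
  · simp only [dKer, LatticeTaylorIndex.dOp_inr_inr_inr, fwdDiff]
    have a2 := hpt _ (supNorm_word_le p i k).2.2.1
    have a1 := hpt _ (supNorm_word_le p i i).1
    have a1' := hpt _ (supNorm_word_le p k k).1
    have a0 := hpt p hp0
    calc |A (p + Pi.single i 1 + Pi.single k 1) y a b - A (p + Pi.single i 1) y a b - (A (p + Pi.single k 1) y a b - A p y a b)|
        ≤ |A (p + Pi.single i 1 + Pi.single k 1) y a b - A (p + Pi.single i 1) y a b| + |A (p + Pi.single k 1) y a b - A p y a b| := abs_sub _ _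
      _ ≤ (|A (p + Pi.single i 1 + Pi.single k 1) y a b| + |A (p + Pi.single i 1) y a b|) + (|A (p + Pi.single k 1) y a b| + |A p y a b|) :=
          add_le_add (abs_sub _ _) (abs_sub _ _)
      _ ≤ 144 * K := by linarith

end Rows


/-! ## §5 The four composed rows of the pairing and the pointwise bound of the remainder integrand -/

section Pairing

variable {A V W : MKer 4 F} {C Cv Cw δ : ℝ} {p q : Pt}

/-- [folklore] `(2(v+w+1))² ≤ 4(v+1)²(w+1)²` for `v, w ≥ 0`. -/
theorem two_mul_sq_le {v w : ℝ} (hv : 0 ≤ v) (hw : 0 ≤ w) : (2 * (v + w + 1)) ^ 2 ≤ 4 * (v + 1) ^ 2 * (w + 1) ^ 2 := by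
  have hab : v + w + 1 ≤ (v + 1) * (w + 1) := by nlinarith [mul_nonneg hv hw]
  have h0 : 0 ≤ v + w + 1 := by positivity
  calc (2 * (v + w + 1)) ^ 2 = 4 * (v + w + 1) ^ 2 := by ring
    _ ≤ 4 * ((v + 1) * (w + 1)) ^ 2 := by gcongr
    _ = 4 * (v + 1) ^ 2 * (w + 1) ^ 2 := by ring

/-- **ROW (P)**: `|(dKer ι A ∘ V)(p, z)_{ac}| ≤ (|F|·144C·C_V·κ₂(δ)·Zl(δ/2))/(‖p−q‖∞+2)² · e^{−δ|z−q|₁}`. [folklore] -/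
theorem abs_rowP_le (hC : 0 ≤ C) (hδ : 0 < δ) (h0 : ∀ (x y : Pt) (a b : F), |A x y a b| ≤ C / ((supNorm (x - y) : ℝ) + 1) ^ 2)
    (hV : BiLoc V q q Cv δ) (ι : Idx 4) (z : Pt) (a c : F) :
    |comp (dKer ι A) V p z a c|
      ≤ (Fintype.card F : ℝ) * (144 * C / ((supNorm (p - q) : ℝ) + 2) ^ 2) * Cv
          * ((((2 : ℕ).factorial : ℝ) * Real.exp (δ / 2) * (2 / δ) ^ 2) * Zl 4 (δ / 2)) * Real.exp (-δ * l1 (z - q)) :=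
  abs_comp_weight_biLoc_le (K := dKer ι A) (x := p) (k := 2) (by positivity) hδ (fun y a' f => abs_dKer_row_le hC h0 ι y a' f) hV z a c

/-- **ROW (ρ₁)**: `|(remKer p A ∘ V)(x, z)_{ac}| ≤ (|F|·3200C(‖x−p‖∞+1)⁸·C_V·κ₅(δ)·Zl(δ/2))/(‖p−q‖∞+2)⁵ · e^{−δ|z−q|₁}`. [folklore] -/
theorem abs_rowR_le (hC : 0 ≤ C) (hδ : 0 < δ)
    (h3 : ∀ (i j k : Fin 4) (x y : Pt) (a b : F),
      |Δ_[(Pi.single i 1 : Pt)] (Δ_[(Pi.single j 1 : Pt)] (Δ_[(Pi.single k 1 : Pt)] fun x' => A x' y a b)) x| ≤ C / ((supNorm (x - y) : ℝ) + 1) ^ 5)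
    (hV : BiLoc V q q Cv δ) (x z : Pt) (a c : F) :
    |comp (remKer p A) V x z a c|
      ≤ (Fintype.card F : ℝ) * (3200 * C * ((supNorm (x - p) : ℝ) + 1) ^ 8 / ((supNorm (p - q) : ℝ) + 2) ^ 5) * Cv
          * ((((5 : ℕ).factorial : ℝ) * Real.exp (δ / 2) * (2 / δ) ^ 5) * Zl 4 (δ / 2)) * Real.exp (-δ * l1 (z - q)) := by
  refine abs_comp_weight_biLoc_le (K := remKer p A) (x := x) (k := 5) (by positivity) hδ (fun y a' f => ?_) hV z a c
  have := abs_remKer_le hC h3 p q x y a' f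
  calc |remKer p A x y a' f| ≤ 3200 * C * ((supNorm (x - p) : ℝ) + 1) ^ 8 * ((supNorm (y - q) : ℝ) + 1) ^ 5 / ((supNorm (p - q) : ℝ) + 2) ^ 5 := this
    _ = 3200 * C * ((supNorm (x - p) : ℝ) + 1) ^ 8 / ((supNorm (p - q) : ℝ) + 2) ^ 5 * ((supNorm (y - q) : ℝ) + 1) ^ 5 := by ring

/-- **ROW (AW)**: `|(A ∘ W)(z, x)_{ca}| ≤ (|F|·4C(‖z−q‖∞+1)²·C_W·κ₂(δ)·Zl(δ/2))/(‖p−q‖∞+2)² · e^{−δ|x−p|₁}`. [folklore] -/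
theorem abs_rowAW_le (hC : 0 ≤ C) (hδ : 0 < δ) (h0 : ∀ (x y : Pt) (a b : F), |A x y a b| ≤ C / ((supNorm (x - y) : ℝ) + 1) ^ 2)
    (hW : BiLoc W p p Cw δ) (z x : Pt) (c a : F) :
    |comp A W z x c a|
      ≤ (Fintype.card F : ℝ) * (4 * C * ((supNorm (z - q) : ℝ) + 1) ^ 2 / ((supNorm (p - q) : ℝ) + 2) ^ 2) * Cw
          * ((((2 : ℕ).factorial : ℝ) * Real.exp (δ / 2) * (2 / δ) ^ 2) * Zl 4 (δ / 2)) * Real.exp (-δ * l1 (x - p)) := by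
  refine abs_comp_weight_biLoc_le (K := A) (x := z) (q := p) (k := 2) (by positivity) hδ (fun t c' g => ?_) hW x c a
  refine (h0 z t c' g).trans ?_
  have hcmp := inv_pow_le_of_box q p z t z le_rfl 2
  rw [supNorm_sub_comm q p] at hcmp
  have hv : (0 : ℝ) ≤ (supNorm (z - q) : ℝ) := Nat.cast_nonneg _
  have hw : (0 : ℝ) ≤ (supNorm (t - p) : ℝ) := Nat.cast_nonneg _
  have hL : (0 : ℝ) < (supNorm (p - q) : ℝ) + 2 := by positivity
  rw [div_eq_mul_one_div]
  refine (mul_le_mul_of_nonneg_left hcmp hC).trans ?_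
  rw [mul_div_assoc']
  rw [div_le_iff₀ (pow_pos hL 2)]
  have := two_mul_sq_le hv hw
  calc C * (2 * ((supNorm (z - q) : ℝ) + (supNorm (t - p) : ℝ) + 1)) ^ 2
      ≤ C * (4 * ((supNorm (z - q) : ℝ) + 1) ^ 2 * ((supNorm (t - p) : ℝ) + 1) ^ 2) := mul_le_mul_of_nonneg_left this hC
    _ = 4 * C * ((supNorm (z - q) : ℝ) + 1) ^ 2 / ((supNorm (p - q) : ℝ) + 2) ^ 2 * ((supNorm (t - p) : ℝ) + 1) ^ 2
          * ((supNorm (p - q) : ℝ) + 2) ^ 2 := by field_simp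

/-- **ROW (ρ₂)**: `|(remKer q A ∘ W)(z, x)_{ca}| ≤ (|F|·3200C(‖z−q‖∞+1)⁸·C_W·κ₅(δ)·Zl(δ/2))/(‖p−q‖∞+2)⁵ · e^{−δ|x−p|₁}`. [folklore] -/
theorem abs_rowR'_le (hC : 0 ≤ C) (hδ : 0 < δ)
    (h3 : ∀ (i j k : Fin 4) (x y : Pt) (a b : F),
      |Δ_[(Pi.single i 1 : Pt)] (Δ_[(Pi.single j 1 : Pt)] (Δ_[(Pi.single k 1 : Pt)] fun x' => A x' y a b)) x| ≤ C / ((supNorm (x - y) : ℝ) + 1) ^ 5)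
    (hW : BiLoc W p p Cw δ) (z x : Pt) (c a : F) :
    |comp (remKer q A) W z x c a|
      ≤ (Fintype.card F : ℝ) * (3200 * C * ((supNorm (z - q) : ℝ) + 1) ^ 8 / ((supNorm (p - q) : ℝ) + 2) ^ 5) * Cw
          * ((((5 : ℕ).factorial : ℝ) * Real.exp (δ / 2) * (2 / δ) ^ 5) * Zl 4 (δ / 2)) * Real.exp (-δ * l1 (x - p)) := by
  refine abs_comp_weight_biLoc_le (K := remKer q A) (x := z) (q := p) (k := 5) (by positivity) hδ (fun t c' g => ?_) hW x c a
  have := abs_remKer_le hC h3 q p z t c' g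
  rw [supNorm_sub_comm q p] at this
  calc |remKer q A z t c' g| ≤ 3200 * C * ((supNorm (z - q) : ℝ) + 1) ^ 8 * ((supNorm (t - p) : ℝ) + 1) ^ 5 / ((supNorm (p - q) : ℝ) + 2) ^ 5 := this
    _ = 3200 * C * ((supNorm (z - q) : ℝ) + 1) ^ 8 / ((supNorm (p - q) : ℝ) + 2) ^ 5 * ((supNorm (t - p) : ℝ) + 1) ^ 5 := by ring

end Pairing

end Summit.QuantumFields.BalabanUV.Beta.FP.LegPairingBounds

end
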